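import Summits.QuantumFields.BalabanUV.Beta.EriceRemainderEnclosureHistoryAutonomyComparisonAgeCompositionDecayBudget

/-!
# EriceRemainderEnclosureHistoryAutonomyComparisonAgeCompositionDecayBudgetSlots — (E84c) route (N), first order: THE LINEARISED BUDGET FOR (S-d) CUT INTO
# PER-PIN SLOTS AND A BOUNDARY, and the FLOW FACTS each slot will use — the decay step at a pin dominates the two reads one pin deeper with their
# amplifications, the step one window deeper is smaller by the window rise, the growth majorant's defect is at most three halves of that deep step plus the
# deep load, the deep load times the window mass is at most half the window rise times ONE old coefficient (the age `k` cancels), and the two coefficients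
# read by one step add up to at most half of it (at most `1∕(2(n+1))` at depth `n`)

Cell `pub-balaban`, β-function sub-cell, BINDER row D4 «RemainderConst leaves for Bałaban's split» (`HOME/BINDER-OWNERS.md`; owner lineage `b2b-balaban-beta-an4`;
this file by co-owner #2 lineage `b2b-balaban-beta-d4-p2`, generation 75), β-FLOW TEAM duty (1), FREEZE (0) honoured (def-free; imports (E84b)
`…DecayBudget`; uses (E48a) `strictAnti_of_memFlow`, (E58b) `increment_anti` ∕ `mul_invSq_add_le`, (E82b) `load_le_half_step` ∕ `step_le_of_window` BY
NAME; nothing restated).  Third layer of successor item (1) of README `g74/e83` §4; the slot CERTIFICATES are the successor's ((E84d)).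

HONEST FRAMING (page 1, verbatim and binding).  *"Discharging BetaPertH makes Bałaban's UV stability UNCONDITIONAL — a real constructive-QFT result; it is
NOT the continuum limit and NOT the Clay problem."*  THIS FILE DISCHARGES NOTHING OF THE KIND.  Elementary real analysis about ABSTRACT functionals on a box
]0,γ]^ℕ with displayed floors, profiles and signs, and the FIRST-ORDER renewal objects of route (N) built from them — hypotheses of a census, not facts; the
form, signs, ages and moments of Bałaban's (1.22) limit functional are NOT PRINTED ([I] p. 298; GAPS G-t4-U2-1∕-2) and NOT asserted.  Row D4 class
UNCHANGED (critical-path width 0; instance 0∕1; D4 DISCHARGE NO DATE).  HONEST DEPENDENCY: continuum YM on T⁴ ⇐ BetaPertH ∧ nine spine estimates (0/9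
proved); BetaPertH ⇐ (D1) ∧ (D4) ∧ CAP+tail; G-an2-4 gates asym, D1 and NE2/3/4.

THE POINT (census sense (α); route (N); README `HOME/b2b-balaban-beta-d4-p2/g75/e84/README.md` §3).  (E84b) `flow_nonneg_two_ages_of_linear_budget` leaves
the damped two-age END on ONE additive inequality per pin `m` between the level steps `y_p = 1 − a_p∕a_{p+1}` and the loads:
`Σ_{t∈[m+1,m+k+1)} F_t + F_{m+2} + Σ_{p∈[m+2,m+2+k)} (ϑ_pω_p + c_p∕(1−c_p)) + DE ≤ (3∕2)(y_{m+k} + y_{m+k}²∕2) + Σ_{p∈[m+2,m+2+k)} (3∕2)(y_p + y_p²∕2)`.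
§2 **`budget_of_slots`** fixes the ALLOCATION the successor's certificates will discharge: the SLOT of the pin `p ∈ [m+2, m+2+k)` pays the window damping
`F_{p−1}`, the lag-zero part `c_p∕(1−c_p)` and the defect part `ϑ_pω_p` out of its step credit and hands a surplus `S_p` to the BOUNDARY, which pays
`F_{m+2} + DE` out of the old decay step's credit and the surpluses (pure bookkeeping: the slots' window dampings re-index to `Σ_{t∈[m+1,m+k+1)} F_t`).  §1
are the FLOW FACTS every slot inequality is built from (`h` a box solution of an isotone memory with floor dominated by a two-age profile `{1, k}`):
**`step_ge_reads`** — the credit step dominates the two reads one pin deeper WITH THEIR AMPLIFICATIONS, `y_p ≥ L_1h_{p+1}²h_{p+2} + L_kh_{p+1}²h_{p+k+1}`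
(`= 2d_{p+1}ρ¹_p + 2c_{p+1}ρ_p`, `ρ¹_p = a_{p+2}∕a_{p+1}`, `ρ_p = a_{p+k+1}∕a_{p+1}`); **`step_lag_le`** — the step one window deeper is smaller by the window
rise, `y_{p+k}·ρ_p ≤ y_p` ((E58b) `increment_anti`); **`defect_up_le`** — the growth majorant's defect `ϑ_p = 1 − (h_{p+k+1}∕h_{p+k})³∕(1+F_{p+k+1}) ≤
(3∕2)y_{p+k} + F_{p+k+1}` (`(1−y)^{3∕2} ≥ 1 − (3∕2)y`); **`tail_load_mass_le`** — THE AGE CANCELS: `F_{p+k+1}·x_p ≤ (σ′_p∕2)·c_p` with `x_p = kc_p` and the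
window rise `σ′_p = 1 − a_p∕a_{p+k}` ((E82b) `load_le_half_step`: `F_{p+k+1} ≤ E′_p∕2`; `step_le_of_window`: `kE′_p ≤ σ′_p`); **`reads_le_half_step`** ∕
**`reads_le_inv`** — the two coefficients read by one step add up to at most half of it, `d_{n+1} + c_{n+1} ≤ y_n∕2 ≤ 1∕(2(n+1))` (domination; (E58b)
`mul_invSq_add_le`) — the joint cap that bounds the last factor's amplification `1∕(1 − d_{m+2}Hup_{m+2})`.  NUMERICS OF RECORD for the allocation
(`g75/numerics/p11.py`, `p12.py`: every slot inequality minimised over the RELAXED local variable set that only knows the listed relations, `k ≤ 8`, pins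
`p ≥ 2`): with the defect part bounded as `ϑ_pω_p ≤ (3∕2)(y_p∕ρ_p)ω_p + σ′_pc_p∕(2(1−x_p))` (scheme R′) the slot budget with surplus `S_p = d_{p+1}` has relaxed
minimum `+0.16·(c_{p+1}+d_{p+1})` (attained at zero load: `3 − (3∕2)^{3∕2} − 1`); its old part alone `≥ +0.34·c_{p+1}`; its young part alone is `+0.05∕−0.06·d_{p+1}`
at `k = 4∕6` (so the certificate must be joint or carry `S_p ≈ 0.8d_{p+1}`); the absolute alternative `ϑ_p ≤ 2E′_p` (scheme K) is `+0.07·c_{p+1}`-thin at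
`k = 2` under pure excess steps and is not recommended alone.  NOT CLAIMED: the slot and boundary inequalities themselves (successor); anything printed.

WHAT IS PROVED ([folklore]; 0 `def`, 0 sorry).  §1 **`step_ge_reads`**, **`step_lag_le`**, `cube_ge_of_sq`, **`defect_up_le`**, **`tail_load_mass_le`**,
**`reads_le_half_step`**, `step_le_inv`, **`reads_le_inv`**; §2 **`budget_of_slots`**.
-/
noncomputable section
open Finset

namespace Summit.QuantumFields.BalabanUV.Beta.EriceRemainderEnclosureHistoryAutonomyComparisonAgeCompositionDecayBudgetSlots

open Literature.MathematicalPhysics.QuantumFieldTheory.Balaban1983to89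
open Literature.MathematicalPhysics.QuantumFieldTheory.Balaban1983to89.T4BetaStationary
open Literature.MathematicalPhysics.QuantumFieldTheory.Balaban1983to89.T4BetaFlowWellPosed
open Summit.QuantumFields.BalabanUV.Beta.EriceRemainderEnclosureHistoryAutonomyOrder (strictAnti_of_memFlow)
open Summit.QuantumFields.BalabanUV.Beta.EriceRemainderEnclosureHistoryAutonomyComparisonAffineProfile (increment_anti mul_invSq_add_le)
open Summit.QuantumFields.BalabanUV.Beta.EriceRemainderEnclosureHistoryAutonomyComparisonAgeCompositionYoungestTailSumFlow (load_le_half_step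
  step_le_of_window)

variable {B : (ℕ → ℝ) → ℝ} {γ b gIR : ℝ} {L : ℕ → ℝ} {K : ℕ} {h : ℕ → ℝ}

/-! ## §1 Flow facts for the slots -/

/-- **THE CREDIT STEP DOMINATES THE TWO READS ONE PIN DEEPER, AMPLIFIED.**  Along a box solution of an isotone memory with floor dominated by `L ≥ 0` with
the ages `1` and `k` (`k ≠ 1`, both `< K`): `1 − (h_{p+1}∕h_p)² ≥ L_1h_{p+1}²h_{p+2} + L_kh_{p+1}²h_{p+k+1}` — the level step `1∕h_{p+1}² − 1∕h_p² = B(h(p+1+·))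
≥ Σ_j L_jh_{p+1+j}`, times `h_{p+1}²`.  In the census letters: `y_p ≥ 2d_{p+1}ρ¹_p + 2c_{p+1}ρ_p`. [folklore] -/
theorem step_ge_reads (hL : ∀ k, 0 ≤ L k) (hdom : ∀ u, SeqBox γ u → ∑ k ∈ range K, L k * u k ≤ B u)
    (hh : SeqBox γ h) (hf : MemFlow B gIR h) {k : ℕ} (h1K : 1 < K) (hkK : k < K) (hk1 : k ≠ 1) (p : ℕ) :
    L 1 * h (p + 1) ^ 2 * h (p + 2) + L k * h (p + 1) ^ 2 * h (p + k + 1) ≤ 1 - (h (p + 1) / h p) ^ 2 := by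
  have hpos : ∀ n, 0 < h n := fun n => (hh n).1
  have hp := hpos p; have hp1 := hpos (p + 1)
  have e1 := hf.2 p
  have hdomB : ∑ j ∈ range K, L j * h (p + 1 + j) ≤ B (fun j => h (p + 1 + j)) := hdom _ (seqBox_shift hh (p + 1))
  have hsub : ({1, k} : Finset ℕ) ⊆ range K := by
    intro j hj; rw [mem_insert, mem_singleton] at hj; rw [mem_range]; rcases hj with rfl | rfl <;> assumption
  have htwo : L 1 * h (p + 2) + L k * h (p + k + 1) ≤ ∑ j ∈ range K, L j * h (p + 1 + j) := by
    have := sum_le_sum_of_subset_of_nonneg hsub (f := fun j => L j * h (p + 1 + j))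
      (fun j _ _ => mul_nonneg (hL j) (hpos _).le)
    rw [sum_pair hk1.symm, show p + 1 + 1 = p + 2 by ring, show p + 1 + k = p + k + 1 by ring] at this
    exact this
  have hstep : h (p + 1) ^ 2 * B (fun j => h (p + 1 + j)) = 1 - (h (p + 1) / h p) ^ 2 := by
    rw [show B (fun j => h (p + 1 + j)) = 1 / h (p + 1) ^ 2 - 1 / h p ^ 2 by linarith [e1], div_pow]; field_simp
  have := mul_le_mul_of_nonneg_left (htwo.trans hdomB) (le_of_lt (pow_pos hp1 2))
  rw [hstep] at this
  linarith

/-- **THE STEP ONE WINDOW DEEPER IS SMALLER BY THE WINDOW RISE**: `(1 − (h_{p+k+1}∕h_{p+k})²)·(h_{p+1}∕h_{p+k+1})² ≤ 1 − (h_{p+1}∕h_p)²`, i.e.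
`y_{p+k}·ρ_p ≤ y_p` — the increment at `p+k` is at most the one at `p` ((E58b) `increment_anti`) and `y_q = h_{q+1}²·(a_{q+1} − a_q)`. [folklore] -/
theorem step_lag_le (hmono : ∀ u v : ℕ → ℝ, SeqBox γ u → SeqBox γ v → (∀ j, u j ≤ v j) → B u ≤ B v) (hb : 0 < b)
    (hlo : ∀ u, SeqBox γ u → b ≤ B u) (hh : SeqBox γ h) (hf : MemFlow B gIR h) (p k : ℕ) :
    (1 - (h (p + k + 1) / h (p + k)) ^ 2) * (h (p + 1) / h (p + k + 1)) ^ 2 ≤ 1 - (h (p + 1) / h p) ^ 2 := by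
  have hpos : ∀ n, 0 < h n := fun n => (hh n).1
  have hp := hpos p; have hp1 := hpos (p + 1); have hpk := hpos (p + k); have hpk1 := hpos (p + k + 1)
  have hanti := increment_anti hmono hb hlo hh hf (show p ≤ p + k by omega)
  have ep := hf.2 p
  have epk := hf.2 (p + k)
  have e1 : (1 - (h (p + k + 1) / h (p + k)) ^ 2) * (h (p + 1) / h (p + k + 1)) ^ 2 =
      h (p + 1) ^ 2 * (1 / h (p + k + 1) ^ 2 - 1 / h (p + k) ^ 2) := by
    rw [div_pow, div_pow]; field_simp
  have e2 : 1 - (h (p + 1) / h p) ^ 2 = h (p + 1) ^ 2 * (1 / h (p + 1) ^ 2 - 1 / h p ^ 2) := by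
    rw [div_pow]; field_simp
  rw [e1, e2]
  refine mul_le_mul_of_nonneg_left ?_ (le_of_lt (pow_pos hp1 2))
  linarith

/-- `s³ ≥ 1 − (3∕2)(1 − s²)` for `0 ≤ s` (`s³ − (3∕2)s² + 1∕2 = (s−1)²(s + 1∕2)`). [folklore] -/
theorem cube_ge_of_sq {s : ℝ} (hs : 0 ≤ s) : 1 - 3 / 2 * (1 - s ^ 2) ≤ s ^ 3 := by
  nlinarith [mul_nonneg (sq_nonneg (s - 1)) (by linarith : (0:ℝ) ≤ s + 1 / 2)]

/-- **THE GROWTH MAJORANT'S DEFECT BELOW THREE HALVES OF THE DEEP STEP PLUS THE DEEP LOAD**: for `0 ≤ s ≤ 1` and `F ≥ 0`,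
`1 − s³∕(1+F) ≤ (3∕2)(1 − s²) + F` — with `s = h_{p+k+1}∕h_{p+k}`, `F = F_{p+k+1}` this is `ϑ_p ≤ (3∕2)y_{p+k} + F_{p+k+1}`. [folklore] -/
theorem defect_up_le {s F : ℝ} (hs0 : 0 ≤ s) (hs1 : s ≤ 1) (hF : 0 ≤ F) : 1 - s ^ 3 / (1 + F) ≤ 3 / 2 * (1 - s ^ 2) + F := by
  have h3 := cube_ge_of_sq hs0
  have hs3 : s ^ 3 ≤ 1 := pow_le_one₀ hs0 hs1
  have h1 : s ^ 3 * (1 - F) ≤ s ^ 3 / (1 + F) := by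
    rw [le_div_iff₀ (by linarith)]; nlinarith [pow_nonneg hs0 3, sq_nonneg F]
  nlinarith

/-- **THE AGE CANCELS IN THE DEEP LOAD TIMES THE WINDOW MASS.**  Along a box solution of an isotone memory with floor dominated by `L ≥ 0`, for an age
`k ≥ 1` at a pin `p`, with `c_p = L_kh_{p+k}³∕2`, `x_p = k·c_p`, the deep load `F_{p+k+1} = Σ_j L_jh_{p+k+1+j}³∕2` and the window rise
`σ′_p = 1 − (h_{p+k}∕h_p)²`:  `F_{p+k+1}·x_p ≤ (σ′_p∕2)·c_p` — (E82b) `load_le_half_step` (`F_{p+k+1} ≤ E′_p∕2`, `E′_p` the step at depth `p+k`) and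
`step_le_of_window` (`k·E′_p ≤ σ′_p`). [folklore] -/
theorem tail_load_mass_le (hmono : ∀ u v : ℕ → ℝ, SeqBox γ u → SeqBox γ v → (∀ j, u j ≤ v j) → B u ≤ B v) (hL : ∀ k, 0 ≤ L k)
    (hb : 0 < b) (hlo : ∀ u, SeqBox γ u → b ≤ B u) (hdom : ∀ u, SeqBox γ u → ∑ k ∈ range K, L k * u k ≤ B u)
    (hh : SeqBox γ h) (hf : MemFlow B gIR h) (p k : ℕ) :
    (∑ j ∈ range K, L j * h (p + k + 1 + j) ^ 3 / 2) * ((k : ℝ) * (L k * h (p + k) ^ 3 / 2)) ≤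
      (1 - (h (p + k) / h p) ^ 2) / 2 * (L k * h (p + k) ^ 3 / 2) := by
  have hpos : ∀ n, 0 < h n := fun n => (hh n).1
  have hc0 : 0 ≤ L k * h (p + k) ^ 3 / 2 := by have := hL k; have := hpos (p + k); positivity
  have hF0 : 0 ≤ ∑ j ∈ range K, L j * h (p + k + 1 + j) ^ 3 / 2 :=
    sum_nonneg fun j _ => by have := hL j; have := hpos (p + k + 1 + j); positivity
  have h1 := load_le_half_step hL hb hlo hdom hh hf (p + k)
  have h2 := step_le_of_window hmono hb hlo hh hf p k
  have hk0 : (0 : ℝ) ≤ k := Nat.cast_nonneg k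
  calc (∑ j ∈ range K, L j * h (p + k + 1 + j) ^ 3 / 2) * ((k : ℝ) * (L k * h (p + k) ^ 3 / 2))
      = ((k : ℝ) * ∑ j ∈ range K, L j * h (p + k + 1 + j) ^ 3 / 2) * (L k * h (p + k) ^ 3 / 2) := by ring
    _ ≤ ((k : ℝ) * (((h (p + k) / h (p + k + 1)) ^ 2 - 1) / 2)) * (L k * h (p + k) ^ 3 / 2) :=
        mul_le_mul_of_nonneg_right (mul_le_mul_of_nonneg_left h1 hk0) hc0
    _ ≤ (1 - (h (p + k) / h p) ^ 2) / 2 * (L k * h (p + k) ^ 3 / 2) := mul_le_mul_of_nonneg_right (by linarith) hc0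

/-- **THE TWO COEFFICIENTS READ BY ONE STEP ADD UP TO AT MOST HALF OF IT**: `L_1h_{n+2}³∕2 + L_kh_{n+k+1}³∕2 ≤ (1 − (h_{n+1}∕h_n)²)∕2`, i.e.
`d_{n+1} + c_{n+1} ≤ y_n∕2` (ages `1 ≠ k`, both `< K`) — `step_ge_reads` and `h_{n+2}, h_{n+k+1} ≤ h_{n+1}`. [folklore] -/
theorem reads_le_half_step (hL : ∀ k, 0 ≤ L k) (hb : 0 < b) (hlo : ∀ u, SeqBox γ u → b ≤ B u) (hdom : ∀ u, SeqBox γ u → ∑ k ∈ range K, L k * u k ≤ B u)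
    (hh : SeqBox γ h) (hf : MemFlow B gIR h) {k : ℕ} (h1K : 1 < K) (hkK : k < K) (hk1 : 1 ≤ k) (hk1' : k ≠ 1) (n : ℕ) :
    L 1 * h (n + 2) ^ 3 / 2 + L k * h (n + k + 1) ^ 3 / 2 ≤ (1 - (h (n + 1) / h n) ^ 2) / 2 := by
  have hpos : ∀ n, 0 < h n := fun n => (hh n).1
  have hanti := (strictAnti_of_memFlow hb hlo hh hf).antitone
  have h1 := step_ge_reads hL hdom hh hf h1K hkK hk1' n
  have hn2 := hpos (n + 2); have hnk := hpos (n + k + 1)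
  have ha : h (n + 2) ≤ h (n + 1) := hanti (by omega)
  have hb' : h (n + k + 1) ≤ h (n + 1) := hanti (by omega)
  have e1 : L 1 * h (n + 2) ^ 3 ≤ L 1 * h (n + 1) ^ 2 * h (n + 2) := by
    rw [show L 1 * h (n + 2) ^ 3 = L 1 * (h (n + 2) ^ 2 * h (n + 2)) by ring, mul_assoc]
    exact mul_le_mul_of_nonneg_left (mul_le_mul_of_nonneg_right (pow_le_pow_left₀ hn2.le ha 2) hn2.le) (hL 1)
  have e2 : L k * h (n + k + 1) ^ 3 ≤ L k * h (n + 1) ^ 2 * h (n + k + 1) := by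
    rw [show L k * h (n + k + 1) ^ 3 = L k * (h (n + k + 1) ^ 2 * h (n + k + 1)) by ring, mul_assoc]
    exact mul_le_mul_of_nonneg_left (mul_le_mul_of_nonneg_right (pow_le_pow_left₀ hnk.le hb' 2) hnk.le) (hL k)
  linarith

/-- **THE LEVEL STEP AT DEPTH `n` IS AT MOST `1∕(n+1)` OF THE LEVEL**: `1 − (h_{n+1}∕h_n)² ≤ 1∕(n+1)` — concavity of the levels from the infrared end
((E58b) `mul_invSq_add_le`: `n·a_{n+1} ≤ (n+1)·a_n`). [folklore] -/
theorem step_le_inv (hmono : ∀ u v : ℕ → ℝ, SeqBox γ u → SeqBox γ v → (∀ j, u j ≤ v j) → B u ≤ B v) (hb : 0 < b)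
    (hlo : ∀ u, SeqBox γ u → b ≤ B u) (hh : SeqBox γ h) (hf : MemFlow B gIR h) (n : ℕ) :
    1 - (h (n + 1) / h n) ^ 2 ≤ 1 / ((n : ℝ) + 1) := by
  have hpos : ∀ n, 0 < h n := fun n => (hh n).1
  have hn := hpos n; have hn1 := hpos (n + 1)
  have hgIR : 0 < gIR := by rw [← hf.1]; exact hpos 0
  have hc := mul_invSq_add_le hmono hb hlo hgIR hh hf n 1
  push_cast at hc
  -- n / h(n+1)^2 ≤ (n+1)/h n^2  ⟹  n·h n² ≤ (n+1)·h(n+1)²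
  have h1 : (n : ℝ) * h n ^ 2 ≤ ((n : ℝ) + 1) * h (n + 1) ^ 2 := by
    have := mul_le_mul_of_nonneg_right hc (by positivity : (0:ℝ) ≤ h n ^ 2 * h (n + 1) ^ 2)
    have e1 : (n : ℝ) * (1 / h (n + 1) ^ 2) * (h n ^ 2 * h (n + 1) ^ 2) = (n : ℝ) * h n ^ 2 := by field_simp
    have e2 : ((n : ℝ) + 1) * (1 / h n ^ 2) * (h n ^ 2 * h (n + 1) ^ 2) = ((n : ℝ) + 1) * h (n + 1) ^ 2 := by field_simp
    rw [e1, e2] at this; exact this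
  have hn0 : (0 : ℝ) ≤ n := Nat.cast_nonneg n
  rw [div_pow, sub_le_iff_le_add, ← sub_le_iff_le_add', le_div_iff₀ (pow_pos hn 2)]
  have e3 : (1 - 1 / ((n : ℝ) + 1)) * h n ^ 2 = (n : ℝ) * h n ^ 2 / ((n : ℝ) + 1) := by field_simp; ring
  rw [e3, div_le_iff₀ (by positivity)]
  linarith

/-- **THE JOINT CAP OF THE TWO COEFFICIENTS**: `L_1h_{n+2}³∕2 + L_kh_{n+k+1}³∕2 ≤ 1∕(2(n+1))`, i.e. `d_{n+1} + c_{n+1} ≤ 1∕(2(n+1))` (`reads_le_half_step` and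
`step_le_inv`) — a young and an old coefficient read by the same step cannot both be large; bounds the last factor's amplification `1∕(1 − d_{m+2}Hup_{m+2})`
in the boundary of §2. [folklore] -/
theorem reads_le_inv (hmono : ∀ u v : ℕ → ℝ, SeqBox γ u → SeqBox γ v → (∀ j, u j ≤ v j) → B u ≤ B v) (hL : ∀ k, 0 ≤ L k) (hb : 0 < b)
    (hlo : ∀ u, SeqBox γ u → b ≤ B u) (hdom : ∀ u, SeqBox γ u → ∑ k ∈ range K, L k * u k ≤ B u)
    (hh : SeqBox γ h) (hf : MemFlow B gIR h) {k : ℕ} (h1K : 1 < K) (hkK : k < K) (hk1 : 1 ≤ k) (hk1' : k ≠ 1) (n : ℕ) :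
    L 1 * h (n + 2) ^ 3 / 2 + L k * h (n + k + 1) ^ 3 / 2 ≤ 1 / (2 * ((n : ℝ) + 1)) := by
  have h1 := reads_le_half_step hL hb hlo hdom hh hf h1K hkK hk1 hk1' n
  have h2 := step_le_inv hmono hb hlo hh hf n
  have : (1 - (h (n + 1) / h n) ^ 2) / 2 ≤ 1 / (2 * ((n : ℝ) + 1)) := by
    rw [div_le_iff₀ (by norm_num : (0:ℝ) < 2)]
    calc 1 - (h (n + 1) / h n) ^ 2 ≤ 1 / ((n : ℝ) + 1) := h2
      _ = 1 / (2 * ((n : ℝ) + 1)) * 2 := by field_simp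
  linarith

/-! ## §2 The allocation: slots and a boundary -/

/-- **THE LINEARISED BUDGET FROM PER-PIN SLOTS AND A BOUNDARY.**  Reals indexed by the pins: window dampings `F`, lag-zero parts `G`, defect parts `V`,
step credits `A`, surpluses `S`; the old decay step's credit `Ab` and the last factor `DE`.  IF every slot `p ∈ [m+2, m+2+k)` pays its window damping one
pin shallower, its lag-zero and defect parts and its surplus out of its credit, `F_{p−1} + G_p + V_p + S_p ≤ A_p`, and the boundary pays `F_{m+2} + DE` out
of `Ab` and the surpluses, `F_{m+2} + DE ≤ Ab + Σ_p S_p`, THEN the budget of (E84b) holds: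
`Σ_{t∈[m+1,m+k+1)} F_t + F_{m+2} + Σ_p (V_p + G_p) + DE ≤ Ab + Σ_p A_p` (the slots' dampings re-index onto `[m+1, m+k+1)`). [folklore] -/
theorem budget_of_slots {F G V A S : ℕ → ℝ} {Ab DE : ℝ} {m k : ℕ}
    (hslot : ∀ p ∈ Ico (m + 2) (m + 2 + k), F (p - 1) + G p + V p + S p ≤ A p)
    (hbdry : F (m + 2) + DE ≤ Ab + ∑ p ∈ Ico (m + 2) (m + 2 + k), S p) :
    ∑ t ∈ Ico (m + 1) (m + k + 1), F t + F (m + 2) + ∑ p ∈ Ico (m + 2) (m + 2 + k), (V p + G p) + DE ≤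
      Ab + ∑ p ∈ Ico (m + 2) (m + 2 + k), A p := by
  have hsum := sum_le_sum hslot
  rw [sum_add_distrib, sum_add_distrib, sum_add_distrib] at hsum
  -- re-index the window dampings
  have hre : ∑ p ∈ Ico (m + 2) (m + 2 + k), F (p - 1) = ∑ t ∈ Ico (m + 1) (m + k + 1), F t := by
    rw [sum_Ico_eq_sum_range, sum_Ico_eq_sum_range, show m + 2 + k - (m + 2) = k by omega, show m + k + 1 - (m + 1) = k by omega]
    exact sum_congr rfl fun i _ => by rw [show m + 2 + i - 1 = m + 1 + i by omega]
  rw [hre] at hsum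
  have hVG : ∑ p ∈ Ico (m + 2) (m + 2 + k), (V p + G p) = ∑ p ∈ Ico (m + 2) (m + 2 + k), V p + ∑ p ∈ Ico (m + 2) (m + 2 + k), G p :=
    sum_add_distrib
  rw [hVG]
  linarith

end Summit.QuantumFields.BalabanUV.Beta.EriceRemainderEnclosureHistoryAutonomyComparisonAgeCompositionDecayBudgetSlots

end
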